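import Literature.MathematicalPhysics.QuantumLattice.HubbardFreePropagator
import HarnessLib

/-!
# The torus Cooper sum: the zero-temperature particle–particle bubble regularised by the torus

Topic `MathematicalPhysics/QuantumLattice`. Over the free band `torusBand L k = -2 Σᵢ cos(2πkᵢ/L)`
of the `L × L` torus (`HubbardFreePropagator.lean`, hopping `1`) this file defines, for an electron
number `N` and a buffer `η ≥ 0`:

* `torusLevelCount L E = #{k ∈ (ℤ/Lℤ)² | ε_L(k) ≤ E}` — the free level-counting function;
* `torusFermiLevel L N = sInf {E | N ≤ 2 · torusLevelCount L E}` — the canonical free Fermi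
  (shell) level `μ_L(N)`: the energy of the `⌈N/2⌉`-th lowest doubly (spin-) degenerate free
  level, i.e. of the shell holding the `N`-th electron of the free Fermi sea; attained and equal
  to a band energy for `1 ≤ N ≤ 2L²` (`torusFermiLevel_isLeast`,
  `exists_torusBand_eq_torusFermiLevel`);
* `torusXi L N k = ε_L(k) - μ_L(N)` — the band energy measured from the shell level;
* `torusShell L N η = {k | |ξ_k| ≤ η}` — the quasi-shell, with dimension
  `torusShellDim L N η = d_sh` (at `η = 0`: the open shell `{ξ_k = 0}`, non-empty for
  `1 ≤ N ≤ 2L²`, `torusShell_zero_nonempty`);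
* `torusCooperSum L N η = L⁻² Σ_{k : η < |ξ_k|} 1/(2|ξ_k|)` — the TORUS COOPER SUM `ℓ_L`.

Physics and provenance. Salmhofer's zero-momentum particle–particle bubble of a
reflection-symmetric dispersion is `B⁻(0) = ∫ dE N(E) β⁻¹Σ_ω (ω² + E²)⁻¹`, with Matsubara sum
`β⁻¹Σ_ω (ω² + E²)⁻¹ = tanh(βE/2)/(2E) → 1/(2|E|)` as `β → ∞` [Salmhofer 1999, §4.5.4,
(4.200)–(4.203); tree: `Literature.Barriers.HubbardSuperconductivity.cooperBubble`, whose
`½N(0) log β` divergence is the barrier `WeakCouplingCeiling`]. At `T = 0` on the FINITE torus the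
frequency integral gives `∫ dk₀/(2π) |ik₀ - ξ_k|⁻² = 1/(2|ξ_k|)` and the momentum integral is the
normalised sum `L⁻² Σ_k`, finite once the finitely many (quasi-)zero modes `|ξ_k| ≤ η` of the open
shell are split off: the torus side `L` (level spacing) replaces the temperature as infrared
regulator, as for ultrasmall superconducting grains, where the level spacing cuts off the pairing
logarithm [Matveev–Larkin 1997, eq. (4) `g̃ = g/(1 - (g/δε) ln(D₀/D))` and the remark after it:
"at zero temperature, `D ∼ δε`" (the level spacing is the low-energy cutoff); von Delft–Ralph
2001]. Requested by route `TorusCooperLog` of summit `HubbardSuperconductivity` (crux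
`CooperLogWindow`: window `U · ℓ_L ≤ c₁`).

API proved here: monotonicity (`torusLevelCount_mono`, `torusShell_mono`,
`torusCooperSum_antitone`), the trivial bounds `0 ≤ ℓ_L(η) ≤ #(shellᶜ)/(2ηL²)`
(`torusCooperSum_nonneg`, `torusCooperSum_le`, `card_compl_torusShell`), non-vacuity
(`torusCooperSum_zero_pos`) and the order structure of the Fermi level. NOT here: the asymptotics
`ℓ_L ≈ 2ρ̄ log L` or any upper bound (research statements of the crux); the elementary lower
bound `ℓ_L(1/L) ≥ c(δ) log L` at `N = 2⌊(1-δ)L²/2⌋` is proved separately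
(`TorusCooperSumLogBound.lean`: `exists_log_le_torusCooperSum_doping`, via
`TorusCooperSumFermiLevel.lean` and `TorusCooperSumRowWalk.lean`).

## Mathlib / tree search

`lean search 'FermiLevel|fermiLevel|CooperSum|levelCount'` — nothing in Mathlib or the tree; the
tree's `chemicalPotentialOfDensity` (`KohnLuttinger.lean`) is the CONTINUUM grand-canonical
object, not the finite-torus canonical shell level. Reused: `torusBand`, `TorusSite`,
`latticeMomentum`; Mathlib `IsLeast.csInf_eq`, `Finset.min'`/`max'`.

## References

* M. Salmhofer, *Renormalization: An Introduction*, Springer 1999, §4.5.4, eqs. (4.200)–(4.205),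
  pp. 137–138. [Salmhofer1999]
* K. A. Matveev, A. I. Larkin, *Parity effect in ground state energies of ultrasmall
  superconducting grains*, Phys. Rev. Lett. 78 (1997) 3749. [MatveevLarkin1997]
* J. von Delft, D. C. Ralph, *Spectroscopy of discrete energy levels in ultrasmall metallic
  grains*, Phys. Rep. 345 (2001) 61–173. [VondelftRalph2001]
* G. Benfatto, A. Giuliani, V. Mastropietro, Ann. Henri Poincaré 7 (2006) 809, eq. (1.4) (the band
  `torusBand`). [BenfattoGiulianiMastropietro2006]
-/

noncomputable section

open Finset
open Literature.Probability.LatticeModels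

namespace Literature.MathematicalPhysics.QuantumLattice

/-! ### The free level-counting function and the canonical Fermi (shell) level -/

section FermiLevel

variable {L : ℕ} [NeZero L]

/-- The momentum grid of the `L × L` torus has `L²` points (also proved problem-side as
`Summit.HubbardSuperconductivity.EnslavedA1g.card_torusSite_two`, which a Literature file cannot
import). [folklore] -/
theorem card_torusSite_two (L : ℕ) [NeZero L] : Fintype.card (TorusSite 2 L) = L ^ 2 := by
  simp [ZMod.card]

/-- The bottom of the band is attained at `k = 0`: `ε_L(0) = -2d` (`cos 0 = 1`). [folklore] -/
theorem torusBand_zero (d L : ℕ) : torusBand L (0 : TorusSite d L) = -2 * d := by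
  simp [torusBand, latticeMomentum]

/-- The band lies in `[-2d, 2d]` (`|cos| ≤ 1`). [folklore] -/
theorem abs_torusBand_le {d : ℕ} (L : ℕ) (k : TorusSite d L) : |torusBand L k| ≤ 2 * d := by
  unfold torusBand
  rw [abs_mul, abs_neg, abs_two]
  gcongr
  calc |∑ i, Real.cos (latticeMomentum L k i)| ≤ ∑ i, |Real.cos (latticeMomentum L k i)| :=
        abs_sum_le_sum_abs _ _
    _ ≤ ∑ _i : Fin d, (1 : ℝ) := sum_le_sum fun i _ => Real.abs_cos_le_one _
    _ = d := by simp

/-- On the square lattice the band lies in `[-4, 4]`: lower bound. [folklore] -/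
theorem neg_four_le_torusBand (L : ℕ) (k : TorusSite 2 L) : -4 ≤ torusBand L k := by
  have := (abs_le.mp (abs_torusBand_le L k)).1
  norm_num at this
  exact this

/-- On the square lattice the band lies in `[-4, 4]`: upper bound. [folklore] -/
theorem torusBand_le_four (L : ℕ) (k : TorusSite 2 L) : torusBand L k ≤ 4 := by
  have := (abs_le.mp (abs_torusBand_le L k)).2
  norm_num at this
  exact this

omit [NeZero L] in
/-- For `L ≥ 2` the band is not constant: `ε_L(e₁) = -2(cos(2π/L) + 1) ≠ -4 = ε_L(0)`.
[folklore] -/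
theorem torusBand_single_ne_torusBand_zero (hL : 2 ≤ L) :
    torusBand L (Pi.single 0 1 : TorusSite 2 L) ≠ torusBand L (0 : TorusSite 2 L) := by
  haveI : Fact (1 < L) := ⟨by omega⟩
  have hLpos : (0 : ℝ) < L := by exact_mod_cast (show 0 < L by omega)
  have hcos : Real.cos (2 * Real.pi / L) ≠ 1 := by
    rw [Ne, Real.cos_eq_one_iff_of_lt_of_lt]
    · positivity
    · have : 0 < 2 * Real.pi / L := by positivity
      linarith [Real.pi_pos]
    · rw [div_lt_iff₀ hLpos]
      have : (2 : ℝ) ≤ L := by exact_mod_cast hL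
      nlinarith [Real.pi_pos]
  have h10 : latticeMomentum L (Pi.single 0 1 : TorusSite 2 L) 0 = 2 * Real.pi / L := by
    simp [latticeMomentum, ZMod.val_one]
  have h11 : latticeMomentum L (Pi.single 0 1 : TorusSite 2 L) 1 = 0 := by
    simp [latticeMomentum]
  rw [torusBand_zero]
  unfold torusBand
  rw [Fin.sum_univ_two, h10, h11, Real.cos_zero]
  intro h
  apply hcos
  push_cast at h
  linarith

variable (L) in
/-- The free level-counting function of the `L × L` torus: the number of momenta
`k ∈ (ℤ/Lℤ)²` with band energy `ε_L(k) = torusBand L k ≤ E` (each such level holds two electrons,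
one per spin). [folklore] -/
def torusLevelCount (E : ℝ) : ℕ :=
  (univ.filter fun k : TorusSite 2 L => torusBand L k ≤ E).card

/-- Unfolding lemma for `torusLevelCount`. [folklore] -/
theorem torusLevelCount_def (E : ℝ) :
    torusLevelCount L E = (univ.filter fun k : TorusSite 2 L => torusBand L k ≤ E).card := rfl

/-- The level-counting function is monotone in the energy. [folklore] -/
theorem torusLevelCount_mono : Monotone (torusLevelCount L) := by
  intro E E' h
  refine card_le_card fun k hk => ?_
  simp only [mem_filter, mem_univ, true_and] at hk ⊢
  exact hk.trans h

/-- There are at most `L²` levels. [folklore] -/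
theorem torusLevelCount_le (E : ℝ) : torusLevelCount L E ≤ L ^ 2 := by
  rw [torusLevelCount_def, ← card_torusSite_two L]
  exact card_le_univ _

/-- Above the top of the band every level is counted. [folklore] -/
theorem torusLevelCount_eq_of_forall_le {E : ℝ} (h : ∀ k : TorusSite 2 L, torusBand L k ≤ E) :
    torusLevelCount L E = L ^ 2 := by
  rw [torusLevelCount_def, ← card_torusSite_two L, filter_true_of_mem fun k _ => h k, card_univ]

variable (L) in
/-- The canonical free Fermi (shell) level of `N` electrons on the `L × L` torus:
`μ_L(N) = inf {E | N ≤ 2 · #{k | ε_L(k) ≤ E}}`, the energy of the `⌈N/2⌉`-th lowest free level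
counted with multiplicity (every momentum level is doubly, spin-, degenerate), i.e. the energy of
the shell occupied by the `N`-th electron of the free Fermi sea. For `1 ≤ N ≤ 2L²` the infimum is
attained (the counting function is a right-continuous step function) and is a band energy
(`torusFermiLevel_isLeast`, `exists_torusBand_eq_torusFermiLevel`). Junk values: for `N = 0` the
set is all of `ℝ` and for `N > 2L²` it is empty; in both cases `sInf` returns `0`. [folklore] -/
def torusFermiLevel (N : ℕ) : ℝ :=
  sInf {E : ℝ | N ≤ 2 * torusLevelCount L E}

/-- Unfolding lemma for `torusFermiLevel`. [folklore] -/
theorem torusFermiLevel_def (N : ℕ) :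
    torusFermiLevel L N = sInf {E : ℝ | N ≤ 2 * torusLevelCount L E} := rfl

/-- The admissible energies `{E | N ≤ 2 · #{ε_L ≤ E}}` have a least element, and it is a band
energy (`1 ≤ N ≤ 2L²`): the least band value that is admissible. [folklore] -/
theorem exists_isLeast_torusBand {N : ℕ} (hN : 0 < N) (hNL : N ≤ 2 * L ^ 2) :
    ∃ k₀ : TorusSite 2 L, IsLeast {E : ℝ | N ≤ 2 * torusLevelCount L E} (torusBand L k₀) := by
  classical
  -- the admissible band values
  set V : Finset ℝ := univ.image (fun k : TorusSite 2 L => torusBand L k) with hV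
  set SV : Finset ℝ := V.filter fun v => N ≤ 2 * torusLevelCount L v with hSV
  have hVne : V.Nonempty := univ_nonempty.image _
  have htop : V.max' hVne ∈ SV := by
    rw [hSV, mem_filter]
    refine ⟨max'_mem _ _, ?_⟩
    rw [torusLevelCount_eq_of_forall_le fun k => le_max' _ _ (mem_image_of_mem _ (mem_univ k))]
    exact hNL
  have hSVne : SV.Nonempty := ⟨_, htop⟩
  obtain ⟨k₀, -, hk₀⟩ : ∃ k₀ ∈ (univ : Finset (TorusSite 2 L)), torusBand L k₀ = SV.min' hSVne := by
    simpa [hV] using (mem_filter.mp (min'_mem SV hSVne)).1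
  refine ⟨k₀, ?_, fun E hE => ?_⟩
  · rw [hk₀]
    exact (mem_filter.mp (min'_mem SV hSVne)).2
  · rw [hk₀]
    by_contra hlt
    push Not at hlt
    -- the band values not exceeding `E`
    set W : Finset ℝ := V.filter fun v => v ≤ E with hW
    by_cases hWne : W.Nonempty
    · have hwW := max'_mem W hWne
      have hwE : W.max' hWne ≤ E := (mem_filter.mp hwW).2
      have hcount : torusLevelCount L E = torusLevelCount L (W.max' hWne) := by
        rw [torusLevelCount_def, torusLevelCount_def]
        congr 1
        ext k
        simp only [mem_filter, mem_univ, true_and]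
        exact ⟨fun hk => le_max' W _ (mem_filter.mpr ⟨mem_image_of_mem _ (mem_univ k), hk⟩),
          fun hk => hk.trans hwE⟩
      have hwSV : W.max' hWne ∈ SV :=
        mem_filter.mpr ⟨(mem_filter.mp hwW).1, by rw [← hcount]; exact hE⟩
      have := min'_le SV _ hwSV
      linarith
    · have hcount : torusLevelCount L E = 0 := by
        rw [torusLevelCount_def, card_eq_zero, filter_eq_empty_iff]
        intro k _ hk
        exact hWne ⟨torusBand L k, mem_filter.mpr ⟨mem_image_of_mem _ (mem_univ k), hk⟩⟩
      have : N ≤ 2 * 0 := by simpa [hcount] using hE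
      omega

/-- **The Fermi level is attained**: for `1 ≤ N ≤ 2L²`, `μ_L(N)` is the least energy `E` with
`N ≤ 2 · #{ε_L ≤ E}`. [folklore] -/
theorem torusFermiLevel_isLeast {N : ℕ} (hN : 0 < N) (hNL : N ≤ 2 * L ^ 2) :
    IsLeast {E : ℝ | N ≤ 2 * torusLevelCount L E} (torusFermiLevel L N) := by
  obtain ⟨k₀, hk₀⟩ := exists_isLeast_torusBand hN hNL
  rw [torusFermiLevel_def, hk₀.csInf_eq]
  exact hk₀

/-- The `N` electrons fit into the levels up to and including the Fermi level:
`N ≤ 2 · #{ε_L ≤ μ_L(N)}` (`1 ≤ N ≤ 2L²`). [folklore] -/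
theorem le_two_mul_torusLevelCount_torusFermiLevel {N : ℕ} (hN : 0 < N) (hNL : N ≤ 2 * L ^ 2) :
    N ≤ 2 * torusLevelCount L (torusFermiLevel L N) :=
  (torusFermiLevel_isLeast hN hNL).1

/-- Strictly below the Fermi level the levels do NOT hold `N` electrons (`1 ≤ N ≤ 2L²`).
[folklore] -/
theorem two_mul_torusLevelCount_lt {N : ℕ} (hN : 0 < N) (hNL : N ≤ 2 * L ^ 2) {E : ℝ}
    (hE : E < torusFermiLevel L N) : 2 * torusLevelCount L E < N := by
  by_contra h
  exact absurd ((torusFermiLevel_isLeast hN hNL).2 (not_lt.mp h)) (not_le.mpr hE)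

/-- The Fermi level is a band energy (`1 ≤ N ≤ 2L²`). [folklore] -/
theorem exists_torusBand_eq_torusFermiLevel {N : ℕ} (hN : 0 < N) (hNL : N ≤ 2 * L ^ 2) :
    ∃ k : TorusSite 2 L, torusBand L k = torusFermiLevel L N := by
  obtain ⟨k₀, hk₀⟩ := exists_isLeast_torusBand hN hNL
  exact ⟨k₀, by rw [torusFermiLevel_def, hk₀.csInf_eq]⟩

/-- The Fermi level lies in the band `[-4, 4]` (`1 ≤ N ≤ 2L²`). [folklore] -/
theorem abs_torusFermiLevel_le {N : ℕ} (hN : 0 < N) (hNL : N ≤ 2 * L ^ 2) :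
    |torusFermiLevel L N| ≤ 4 := by
  obtain ⟨k, hk⟩ := exists_torusBand_eq_torusFermiLevel hN hNL
  rw [← hk]
  have := abs_torusBand_le L k
  norm_num at this
  exact this

/-- One or two electrons sit at the bottom of the band: `μ_L(1) = μ_L(2) = -4`. [folklore] -/
theorem torusFermiLevel_eq_neg_four {N : ℕ} (hN : 0 < N) (hN2 : N ≤ 2) :
    torusFermiLevel L N = -4 := by
  have hL : 1 ≤ L ^ 2 := Nat.one_le_pow _ _ (Nat.pos_of_ne_zero (NeZero.ne L))
  refine ((torusFermiLevel_isLeast hN (by omega)).unique ⟨?_, fun E hE => ?_⟩)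
  · -- `k = 0` is a level at energy `-4`
    have h1 : 1 ≤ torusLevelCount L (-4) := by
      rw [torusLevelCount_def, Nat.one_le_iff_ne_zero, Ne, card_eq_zero, ← Ne,
        ← nonempty_iff_ne_empty]
      exact ⟨0, by norm_num [torusBand_zero]⟩
    change N ≤ 2 * torusLevelCount L (-4)
    omega
  · by_contra hlt
    push Not at hlt
    have h0 : torusLevelCount L E = 0 := by
      rw [torusLevelCount_def, card_eq_zero, filter_eq_empty_iff]
      intro k _ hk
      linarith [neg_four_le_torusBand L k]
    have : N ≤ 2 * torusLevelCount L E := hE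
    omega

end FermiLevel

/-! ### Energies measured from the shell, the quasi-shell, and the torus Cooper sum -/

section CooperSum

variable {L : ℕ} [NeZero L] {N : ℕ}

variable (L N) in
/-- The free band energy measured from the canonical shell level:
`ξ_k = ε_L(k) - μ_L(N)`. [folklore] -/
def torusXi (k : TorusSite 2 L) : ℝ :=
  torusBand L k - torusFermiLevel L N

/-- Unfolding lemma for `torusXi`. [folklore] -/
theorem torusXi_def (k : TorusSite 2 L) : torusXi L N k = torusBand L k - torusFermiLevel L N :=
  rfl

variable (L N) in
/-- The quasi-shell of half-width `η`: the momenta within `η` of the shell level,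
`{k | |ξ_k| ≤ η}`; at `η = 0` the open shell `{k | ξ_k = 0}` (the exact zero modes). [folklore] -/
def torusShell (η : ℝ) : Finset (TorusSite 2 L) :=
  univ.filter fun k => |torusXi L N k| ≤ η

/-- Membership in the quasi-shell. [folklore] -/
@[simp] theorem mem_torusShell {η : ℝ} {k : TorusSite 2 L} :
    k ∈ torusShell L N η ↔ |torusXi L N k| ≤ η := by
  simp [torusShell]

/-- Membership in the complement of the quasi-shell: `η < |ξ_k|`. [folklore] -/
theorem mem_compl_torusShell {η : ℝ} {k : TorusSite 2 L} :
    k ∈ (torusShell L N η)ᶜ ↔ η < |torusXi L N k| := by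
  simp [torusShell]

variable (L N) in
/-- The shell dimension `d_sh(η) = #{k | |ξ_k| ≤ η}`. [folklore] -/
abbrev torusShellDim (η : ℝ) : ℕ := (torusShell L N η).card

/-- The open shell is `{k | ξ_k = 0}`. [folklore] -/
theorem torusShell_zero : torusShell L N 0 = univ.filter fun k => torusXi L N k = 0 := by
  ext k
  simp [torusShell, abs_nonpos_iff]

/-- The quasi-shell grows with `η`. [folklore] -/
theorem torusShell_mono : Monotone (torusShell L N) := by
  intro η η' h k hk
  rw [mem_torusShell] at hk ⊢
  exact hk.trans h

/-- For `η < 0` the quasi-shell is empty. [folklore] -/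
theorem torusShell_eq_empty {η : ℝ} (hη : η < 0) : torusShell L N η = ∅ := by
  ext k
  simp only [mem_torusShell, Finset.notMem_empty, iff_false, not_le]
  exact hη.trans_le (abs_nonneg _)

/-- The open shell is non-empty: the Fermi level is a band energy (`1 ≤ N ≤ 2L²`). [folklore] -/
theorem torusShell_zero_nonempty (hN : 0 < N) (hNL : N ≤ 2 * L ^ 2) :
    (torusShell L N 0).Nonempty := by
  obtain ⟨k, hk⟩ := exists_torusBand_eq_torusFermiLevel hN hNL
  exact ⟨k, by simp [torusXi, hk]⟩

/-- The number of momenta outside the quasi-shell is `L² - d_sh`. [folklore] -/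
theorem card_compl_torusShell (η : ℝ) :
    (torusShell L N η)ᶜ.card = L ^ 2 - torusShellDim L N η := by
  rw [card_compl, card_torusSite_two]

variable (L N) in
/-- **The torus Cooper sum** `ℓ_L(η) = L⁻² Σ_{k : η < |ξ_k|} 1/(2|ξ_k|)`: the zero-temperature,
finite-volume particle–particle bubble of the free band measured from the canonical shell level,
with the momenta of the quasi-shell `|ξ_k| ≤ η` removed (`η = 0` removes exactly the zero modes,
`torusCooperSum_zero`). The kernel `1/(2|ξ|)` is the `β → ∞` limit of Salmhofer's Matsubara sum
`β⁻¹ Σ_ω (ω² + ξ²)⁻¹ = tanh(βξ/2)/(2ξ)` in the bubble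
`B⁻(0) = ∫ dE N(E) tanh(βE/2)/(2E) = ½N(0) log(βε₀/2) + O(1)`; here the torus side `L`, not the
temperature, is the infrared regulator (level spacing as the low-energy cutoff of the pairing
logarithm, as for ultrasmall grains: Matveev–Larkin 1997, eq. (4) and the remark after it;
von Delft–Ralph 2001). [cite: Salmhofer1999, §4.5.4 eqs. (4.200)–(4.203), pp. 137–138] -/
def torusCooperSum (η : ℝ) : ℝ :=
  ((L : ℝ) ^ 2)⁻¹ *
    ∑ k ∈ univ.filter (fun k : TorusSite 2 L => η < |torusXi L N k|), 1 / (2 * |torusXi L N k|)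

/-- Unfolding lemma for `torusCooperSum`. [folklore] -/
theorem torusCooperSum_def (η : ℝ) :
    torusCooperSum L N η = ((L : ℝ) ^ 2)⁻¹ *
      ∑ k ∈ univ.filter (fun k : TorusSite 2 L => η < |torusXi L N k|),
        1 / (2 * |torusXi L N k|) := rfl

/-- The summation range of the Cooper sum is the complement of the quasi-shell. [folklore] -/
theorem filter_lt_abs_torusXi (η : ℝ) :
    (univ.filter fun k : TorusSite 2 L => η < |torusXi L N k|) = (torusShell L N η)ᶜ := by
  ext k
  simp [torusShell]

/-- The Cooper sum as a sum over the complement of the quasi-shell. [folklore] -/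
theorem torusCooperSum_eq_sum_compl (η : ℝ) :
    torusCooperSum L N η =
      ((L : ℝ) ^ 2)⁻¹ * ∑ k ∈ (torusShell L N η)ᶜ, 1 / (2 * |torusXi L N k|) := by
  rw [torusCooperSum_def, filter_lt_abs_torusXi]

/-- At `η = 0` the Cooper sum runs over exactly the non-zero modes `ξ_k ≠ 0`. [folklore] -/
theorem torusCooperSum_zero :
    torusCooperSum L N 0 =
      ((L : ℝ) ^ 2)⁻¹ * ∑ k ∈ univ.filter (fun k : TorusSite 2 L => torusXi L N k ≠ 0),
        1 / (2 * |torusXi L N k|) := by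
  rw [torusCooperSum_def]
  simp only [abs_pos]

/-- The Cooper sum is non-negative. [folklore] -/
theorem torusCooperSum_nonneg (η : ℝ) : 0 ≤ torusCooperSum L N η :=
  mul_nonneg (by positivity) (sum_nonneg fun k _ => by positivity)

/-- **Non-vacuity**: for `L ≥ 2` the zero-buffer Cooper sum is strictly positive (the band is
not constant, so some `ξ_k ≠ 0`; this holds for every `N`, the shift `μ_L(N)` being common to all
`ξ_k`). [folklore] -/
theorem torusCooperSum_zero_pos (hL : 2 ≤ L) : 0 < torusCooperSum L N 0 := by
  have hL0 : (L : ℝ) ≠ 0 := Nat.cast_ne_zero.mpr (NeZero.ne L)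
  rw [torusCooperSum_zero]
  refine mul_pos (by positivity) (sum_pos' (fun k _ => by positivity) ?_)
  by_cases h0 : torusXi L N 0 = 0
  · have h1 : torusXi L N (Pi.single 0 1) ≠ 0 := by
      intro h1
      apply torusBand_single_ne_torusBand_zero hL
      rw [torusXi_def, sub_eq_zero] at h0 h1
      rw [h0, h1]
    have : 0 < |torusXi L N (Pi.single 0 1)| := abs_pos.mpr h1
    exact ⟨Pi.single 0 1, by simpa using h1, by positivity⟩
  · have : 0 < |torusXi L N 0| := abs_pos.mpr h0
    exact ⟨0, by simpa using h0, by positivity⟩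

/-- **Monotonicity in the buffer**: enlarging `η` removes (non-negative) terms. [folklore] -/
theorem torusCooperSum_antitone : Antitone (torusCooperSum L N) := by
  intro η η' h
  rw [torusCooperSum_def, torusCooperSum_def]
  refine mul_le_mul_of_nonneg_left ?_ (by positivity)
  refine sum_le_sum_of_subset_of_nonneg (fun k hk => ?_) fun k _ _ => by positivity
  simp only [mem_filter, mem_univ, true_and] at hk ⊢
  exact h.trans_lt hk

/-- **The trivial upper bound**: for `η > 0`,
`ℓ_L(η) ≤ #{k | η < |ξ_k|} / (2ηL²) = (L² - d_sh)/(2ηL²)`. [folklore] -/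
theorem torusCooperSum_le {η : ℝ} (hη : 0 < η) :
    torusCooperSum L N η ≤ ((torusShell L N η)ᶜ.card : ℝ) / (2 * η * (L : ℝ) ^ 2) := by
  have hL : (L : ℝ) ≠ 0 := Nat.cast_ne_zero.mpr (NeZero.ne L)
  rw [torusCooperSum_eq_sum_compl]
  calc ((L : ℝ) ^ 2)⁻¹ * ∑ k ∈ (torusShell L N η)ᶜ, 1 / (2 * |torusXi L N k|)
      ≤ ((L : ℝ) ^ 2)⁻¹ * ∑ k ∈ (torusShell L N η)ᶜ, 1 / (2 * η) := by
        gcongr with k hk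
        exact (mem_compl_torusShell.mp hk).le
    _ = ((torusShell L N η)ᶜ.card : ℝ) / (2 * η * (L : ℝ) ^ 2) := by
        rw [sum_const, nsmul_eq_mul]
        field_simp

/-- The trivial upper bound in terms of the shell dimension: `ℓ_L(η) ≤ (L² - d_sh)/(2ηL²)`
(`η > 0`). [folklore] -/
theorem torusCooperSum_le' {η : ℝ} (hη : 0 < η) :
    torusCooperSum L N η ≤ ((L ^ 2 - torusShellDim L N η : ℕ) : ℝ) / (2 * η * (L : ℝ) ^ 2) := by
  rw [← card_compl_torusShell]
  exact torusCooperSum_le hη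

/-- In particular `ℓ_L(η) ≤ 1/(2η)` (`η > 0`). [folklore] -/
theorem torusCooperSum_le_inv {η : ℝ} (hη : 0 < η) : torusCooperSum L N η ≤ 1 / (2 * η) := by
  have hL : (0 : ℝ) < (L : ℝ) ^ 2 := by have := NeZero.ne L; positivity
  have hcard : ((torusShell L N η)ᶜ.card : ℝ) ≤ (L : ℝ) ^ 2 := by
    rw [← Nat.cast_pow, ← card_torusSite_two L]
    exact_mod_cast card_le_univ _
  refine (torusCooperSum_le hη).trans ?_
  rw [div_le_div_iff₀ (by positivity) (by positivity), one_mul]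
  nlinarith

end CooperSum

end Literature.MathematicalPhysics.QuantumLattice
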